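import Literature.AlgebraicGeometry.AbelianSchemes.AbelianSchemeQuotientDualPairUnique
import Literature.AlgebraicGeometry.AbelianSchemes.ClassifyingMapFpqcDescent
import Literature.AlgebraicGeometry.AbelianSchemes.RigidifiedGluingOfCechPic
import HarnessLib

/-!
# The universal property of the rigidified Poincaré sheaf of `A/K` from fpqc-LOCAL existence, descent of rigidified
# isomorphisms, and the stabiliser hypothesis (K) — the `h4` binder of `dualPairOfQuotientRigidified` (HECKE-LINK H2, D6 (α2))

Layer `Literature/AlgebraicGeometry/AbelianSchemes`, namespace `Literature.AlgebraicGeometry.AbelianSchemes.AbelianSchemeOver`.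
THEOREMS ONLY; no definition, no named fact, no instance, no notation, no `sorry`.

Setting of ★ `AbelianSchemeQuotientDualPairRigidified` / ★ `AbelianSchemeQuotientDualPairUnique` ((ii) part 3): `B := A/K`,
`ψ̂ : Â → Â/K′`, the rigidified descended Poincaré sheaf `𝒫_B^{rig}` (★ `poincareQuotRigid`) on `B ×_S Â/K′`.  The last field
of the dual pair `(Â/K′, 𝒫_B^{rig})` of `B` (★ `dualPairOfQuotientRigidified … h4`) is the UNIVERSAL PROPERTY
`h4 : ∀ f ℒ, ℒ.FibrewisePicZero → ∃! g : T → Â/K′ over f, (1_B × g)^* 𝒫_B^{rig} ≅ ℒ.L` ([MumfordAV1970] §13 p. 125, §15 Thm. 1).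
★ `existsUnique_poincareQuotRigid_of_exists` reduces the `∃!` to its `∃` half `hex` given the stabiliser hypothesis **(K)**
`hStab`; this file proves `hex` — hence `h4` — from three inputs, each a NAMED HYPOTHESIS in the head shape of the brick that
produces it (cell hodgecm-mathlib, B-plan1 (g15) 2026-08-30T00:10:10Z: D6 `h4` ∃-package, lead B-p08 (g10), second hand
B-p18 (g17)):

* **(K) `hStab`** — VERBATIM as in ★ `existsUnique_poincareQuotRigid_of_exists` (the scheme-theoretic stabiliser of `𝒩₁` is
  `K′`; bricks (K1)–(K5) of the cell);
* **(C) `hloc` — fpqc-LOCAL EXISTENCE** — the conclusion of B-p08 (g10)'s (u1)+(u2) head `exists_fpqcCover_pullback_poincareQuotRigid_iso`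
  (file `AbelianSchemeQuotientDualPairExistsLocal`), universally closed over the test datum `(f, ℒ, hℒ)`, WITH the cover `c`
  exported affine (`IsAffineHom c`; there `c := [n]`-division cover, finite): for every rigidified fibrewise-`Pic⁰` family `ℒ` on
  `B_T` there are an fpqc cover `c : T₁ → T` (surjective, flat, quasi-compact, affine) and `g₁ : T₁ → Â/K′` over `c ≫ f` with
  `(1_B × g₁)^* 𝒫_B^{rig} ≅ (1_B × c)^* ℒ.L`;
* **(u6b) `hdesc` — DESCENT OF ISOMORPHISMS OF RIGIDIFIED LINE BUNDLES along an affine faithfully flat `c`** (B-p13 (g17)'s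
  `RigidifiedTrivialFpqcDescent`, two-module form): two rigidified line bundles on `B_T` that become isomorphic on `B_{T₁}` are
  isomorphic ([MumfordAV1970] §5 Cor. 6 (p. 54) + fpqc descent; the Stein property of `B_T → T`).

Then:

* `nonempty_pullback_prodMap_pullback_baseChangeToProd_iso_of_comp_eq` — `(1_B × c)^* (1_B × g)^* P ≅ (1_B × g₁)^* P` for
  `c ≫ g = g₁` (★ `prodMap_comp_baseChangeToProd`);
* **`exists_pullback_poincareQuotRigid_iso_of_fpqcLocal (hStab) (hdesc) (hloc) (f) (ℒ) (hℒ)`** — the `∃` half `hex`: descend the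
  local classifying map `g₁` along `c` by ★ (u6a) `exists_desc_of_solution_of_unique` (solutions are unique by ★
  `eq_of_pullback_baseChangeToProd_poincareQuotRigid_iso hStab`) to `g : T → Â/K′`; `(1_B × g)^* 𝒫_B^{rig}` is RIGIDIFIED (★
  `nonempty_pullback_unitSection_baseChangeToProd_iso` over ★ `rigid_poincareQuotRigid`) and agrees with `ℒ` after `(1_B × c)^*`,
  so `hdesc` gives `(1_B × g)^* 𝒫_B^{rig} ≅ ℒ.L`;
* **`universal_poincareQuotRigid_of_fpqcLocal (hStab) (hdesc) (hloc)`** — the `h4` binder of ★ `dualPairOfQuotientRigidified`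
  TOKEN-FOR-TOKEN (★ `existsUnique_poincareQuotRigid_of_exists` over the previous).

HC_CM is proved only modulo the 7 printed citations until rung 0 closes; nothing here is about HC.

## References
* [MumfordAV1970] D. Mumford, *Abelian Varieties* (1970), §5 Cor. 6 (p. 54), §13 (p. 125), §15 Thm. 1 (p. 143).
* [MilneAV2008] J. S. Milne, *Abelian Varieties* (2008), I §8 (pp. 36–37), I §9 Thm. 9.1 (p. 42).
* [GortzWedhorn2020] U. Görtz, T. Wedhorn, *Algebraic Geometry I*, 2nd ed. (2020), Thm. 14.72 (fpqc descent of morphisms),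
  Section (4.7) (pp. 107–108).
* [MumfordFogartyKirwan1994] D. Mumford, J. Fogarty, F. Kirwan, *Geometric Invariant Theory*, 3rd ed. (1994), Ch. 6 §2 (p. 121).
-/

noncomputable section

universe u

open CategoryTheory CategoryTheory.Limits AlgebraicGeometry MonoidalCategory CartesianMonoidalCategory
open scoped MonObj

namespace Literature.AlgebraicGeometry.AbelianSchemes

namespace AbelianSchemeOver

open Literature.AlgebraicGeometry.RelativeSpec Literature.AlgebraicGeometry.AbelianVarieties
  Literature.AlgebraicGeometry.Motives Literature.AlgebraicGeometry.Modules

/-! ### §0 One plumbing isomorphism -/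

/-- `(1_A × c)^* (1_A × g)^* P ≅ (1_A × g₁)^* P` whenever `c ≫ g = g₁` (★ `prodMap_comp_baseChangeToProd`: `(1_A × c) ≫ (1_A × g)
= 1_A × (c ≫ g)`). [cite: GortzWedhorn2020, Section (4.7) (pp. 107–108)] [cite: MilneAV2008, I §8 pp. 36–37] -/
theorem nonempty_pullback_prodMap_pullback_baseChangeToProd_iso_of_comp_eq {S : Scheme.{u}} (A B : AbelianSchemeOver S)
    (P : (A.prodLeft B).Modules) {T₁ T : Scheme.{u}} (f : T ⟶ S) (c : T₁ ⟶ T) (g : T ⟶ B.X.left)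
    (hg : g ≫ B.X.hom = f) (g₁ : T₁ ⟶ B.X.left) (hg₁ : g₁ ≫ B.X.hom = c ≫ f) (hcg : c ≫ g = g₁) :
    Nonempty ((Scheme.Modules.pullback (A.prodMap (c ≫ f) f c rfl)).obj
        ((Scheme.Modules.pullback (A.baseChangeToProd B f g hg)).obj P) ≅
      (Scheme.Modules.pullback (A.baseChangeToProd B (c ≫ f) g₁ hg₁)).obj P) := by
  subst hcg
  exact ⟨(Scheme.Modules.pullbackComp _ _).app P ≪≫
    (Scheme.Modules.pullbackCongr (A.prodMap_comp_baseChangeToProd B (c ≫ f) f c rfl g hg)).app P⟩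

/-! ### §1 The setting of ★ `AbelianSchemeQuotientDualPairUnique` (variable block verbatim) -/

variable {S : Scheme.{u}} (A : AbelianSchemeOver S)
  {Y : Scheme.{u}} (u : S ⟶ Y) (K : Subgroup A.Sections) [IsCommMonObj A.X] {n : ℕ}
  (hK : ∀ σ : K, (σ : A.Sections) ^ n = 1)
  [Finite K] [Y.IsSeparated] [IsSeparated (A.X.hom ≫ u)] [S.IsSeparated]
  (hcov : ∀ x : A.left, ∃ O : (A.translationActionOver u K).StableAffineOpens, x ∈ O.1)
  [LocallyOfFiniteType (A.X.hom ≫ u)] [IsLocallyNoetherian Y]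
  (hG : ∃ _ : GrpObj (A.quotientOver u K), IsMonHom (A.quotientMk u K hcov))
  (hsm : Smooth (A.quotientOver u K).hom) (hgc : GeometricallyConnected (A.quotientOver u K).hom)
  (D : A.DualPair) [IsAffine Y]
  (hfree : ∀ (Ω : Type u) [Field Ω] [IsAlgClosed Ω] (x : Spec (.of Ω) ⟶ A.left) (σ : K), σ ≠ 1 →
    x ≫ (A.translation (σ : A.Sections)).left ≠ x)

variable
  -- the dual side: a finite subgroup `K′ ≤ Â(S)` with the file-(i) hypotheses for `(Â, K′)`
  (K' : Subgroup D.hat.Sections) [Finite K'] [IsSeparated (D.hat.X.hom ≫ u)]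
  (hcov' : ∀ x : D.hat.left, ∃ O : (D.hat.translationActionOver u K').StableAffineOpens, x ∈ O.1)
  [LocallyOfFiniteType (D.hat.X.hom ≫ u)]
  (hG' : ∃ _ : GrpObj (D.hat.quotientOver u K'), IsMonHom (D.hat.quotientMk u K' hcov'))
  (hsm' : Smooth (D.hat.quotientOver u K').hom) (hgc' : GeometricallyConnected (D.hat.quotientOver u K').hom)
  (hfree' : ∀ (Ω : Type u) [Field Ω] [IsAlgClosed Ω] (x : Spec (.of Ω) ⟶ D.hat.left) (σ : K'), σ ≠ 1 →
    x ≫ (D.hat.translation (σ : D.hat.Sections)).left ≠ x)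
  -- D3b's output: a `K′`-equivariant structure on `𝒩₁` for the D3a action
  (Φ : (prodTranslationActionOver (A.quotientBy u K hcov hG hsm hgc) D.hat u K' hcov').EquivariantStructure
    (A.poincarePullback u K hK hcov hG hsm hgc D hfree))

/-! ### §2 The `∃` half of the universal property from (C) local existence + (u6b) descent + (K) -/

include hfree' in
/-- **The EXISTENCE half of the universal property of `(Â/K′, 𝒫_B^{rig})` — the `hex` input of ★
`existsUnique_poincareQuotRigid_of_exists` — from (K) `hStab`, (u6b) `hdesc` and (C) `hloc`.**  Given a rigidified fibrewise-`Pic⁰`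
family `ℒ` on `B_T` (`B := A/K`): (C) gives an affine fpqc cover `c : T₁ → T` and a classifying map `g₁ : T₁ → Â/K′` of
`(1_B × c)^* ℒ`; classifying maps of `𝒫_B^{rig}` are UNIQUE over every test scheme (★ `eq_of_pullback_baseChangeToProd_poincareQuotRigid_iso`
from (K)), so `g₁` descends along `c` (★ `exists_desc_of_solution_of_unique`, [GortzWedhorn2020] Thm. 14.72) to `g : T → Â/K′`
over `f`; `(1_B × g)^* 𝒫_B^{rig}` is a RIGIDIFIED line bundle (★ `nonempty_pullback_unitSection_baseChangeToProd_iso` over ★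
`rigid_poincareQuotRigid`, rank one by ★ `hasRank_poincareQuotRigid`) which becomes isomorphic to `ℒ` after `(1_B × c)^*`
(`c ≫ g = g₁`), hence is isomorphic to `ℒ` by (u6b). [cite: MumfordAV1970, §13 (p. 125) and §15 Thm. 1 (p. 143)]
[cite: MilneAV2008, I §8 pp. 36–37] [cite: GortzWedhorn2020, Thm. 14.72] -/
theorem exists_pullback_poincareQuotRigid_iso_of_fpqcLocal
    (hStab : ∀ {T : Scheme.{u}} (f : T ⟶ S) (a a' : T ⟶ D.hat.X.left) (ha : a ≫ D.hat.X.hom = f)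
      (ha' : a' ≫ D.hat.X.hom = f),
      Nonempty ((Scheme.Modules.pullback ((A.quotientBy u K hcov hG hsm hgc).baseChangeToProd D.hat f a ha)).obj
          (A.poincarePullbackBundle u K hK hcov hG hsm hgc D hfree).L ≅
        (Scheme.Modules.pullback ((A.quotientBy u K hcov hG hsm hgc).baseChangeToProd D.hat f a' ha')).obj
          (A.poincarePullbackBundle u K hK hcov hG hsm hgc D hfree).L) →
      a ≫ (D.hat.quotientMk u K' hcov').left = a' ≫ (D.hat.quotientMk u K' hcov').left)
    (hdesc : ∀ {T₁ T : Scheme.{u}} (f : T ⟶ S) (c : T₁ ⟶ T) [IsAffineHom c] [Flat c] [Surjective c]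
      (M₁ M₂ : (A.quotientBy u K hcov hG hsm hgc).RigidifiedLineBundle f),
      Nonempty ((Scheme.Modules.pullback ((A.quotientBy u K hcov hG hsm hgc).prodMap (c ≫ f) f c rfl)).obj M₁.L ≅
        (Scheme.Modules.pullback ((A.quotientBy u K hcov hG hsm hgc).prodMap (c ≫ f) f c rfl)).obj M₂.L) →
      Nonempty (M₁.L ≅ M₂.L))
    (hloc : ∀ {T : Scheme.{u}} (f : T ⟶ S) (ℒ : (A.quotientBy u K hcov hG hsm hgc).RigidifiedLineBundle f),
      ℒ.FibrewisePicZero →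
      ∃ (T₁ : Scheme.{u}) (c : T₁ ⟶ T) (_ : Surjective c) (_ : Flat c) (_ : QuasiCompact c) (_ : IsAffineHom c)
        (g₁ : T₁ ⟶ (D.hat.quotientBy u K' hcov' hG' hsm' hgc').X.left)
        (hg₁ : g₁ ≫ (D.hat.quotientBy u K' hcov' hG' hsm' hgc').X.hom = c ≫ f),
        Nonempty ((Scheme.Modules.pullback ((A.quotientBy u K hcov hG hsm hgc).baseChangeToProd
            (D.hat.quotientBy u K' hcov' hG' hsm' hgc') (c ≫ f) g₁ hg₁)).obj
              (A.poincareQuotRigid u K hK hcov hG hsm hgc D hfree K' hcov' hG' hsm' hgc' Φ) ≅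
          (Scheme.Modules.pullback ((A.quotientBy u K hcov hG hsm hgc).prodMap (c ≫ f) f c rfl)).obj ℒ.L))
    {T : Scheme.{u}} (f : T ⟶ S) (ℒ : (A.quotientBy u K hcov hG hsm hgc).RigidifiedLineBundle f)
    (hℒ : ℒ.FibrewisePicZero) :
    ∃ g : {g : T ⟶ (D.hat.quotientBy u K' hcov' hG' hsm' hgc').X.left //
        g ≫ (D.hat.quotientBy u K' hcov' hG' hsm' hgc').X.hom = f},
      Nonempty ((Scheme.Modules.pullback ((A.quotientBy u K hcov hG hsm hgc).baseChangeToProd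
        (D.hat.quotientBy u K' hcov' hG' hsm' hgc') f g.1 g.2)).obj
          (A.poincareQuotRigid u K hK hcov hG hsm hgc D hfree K' hcov' hG' hsm' hgc' Φ) ≅ ℒ.L) := by
  -- (C): local existence on an affine fpqc cover `c : T₁ → T`
  obtain ⟨T₁, c, hc₁, hc₂, hc₃, hc₄, g₁, hg₁, e₁⟩ := hloc f ℒ hℒ
  -- (K) ⇒ uniqueness of solutions over every test scheme ⇒ (u6a) the local classifying map descends along `c`
  have huniq : ∀ {T : Scheme.{u}} (f : T ⟶ S)
      (g₁ g₂ : T ⟶ (D.hat.quotientBy u K' hcov' hG' hsm' hgc').X.left)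
      (hg₁ : g₁ ≫ (D.hat.quotientBy u K' hcov' hG' hsm' hgc').X.hom = f)
      (hg₂ : g₂ ≫ (D.hat.quotientBy u K' hcov' hG' hsm' hgc').X.hom = f),
      Nonempty ((Scheme.Modules.pullback ((A.quotientBy u K hcov hG hsm hgc).baseChangeToProd
          (D.hat.quotientBy u K' hcov' hG' hsm' hgc') f g₁ hg₁)).obj
            (A.poincareQuotRigid u K hK hcov hG hsm hgc D hfree K' hcov' hG' hsm' hgc' Φ) ≅
        (Scheme.Modules.pullback ((A.quotientBy u K hcov hG hsm hgc).baseChangeToProd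
          (D.hat.quotientBy u K' hcov' hG' hsm' hgc') f g₂ hg₂)).obj
            (A.poincareQuotRigid u K hK hcov hG hsm hgc D hfree K' hcov' hG' hsm' hgc' Φ)) → g₁ = g₂ :=
    fun f g₁ g₂ hg₁ hg₂ h =>
      A.eq_of_pullback_baseChangeToProd_poincareQuotRigid_iso u K hK hcov hG hsm hgc D hfree K' hcov' hG' hsm' hgc' hfree' Φ
        hStab f g₁ g₂ hg₁ hg₂ h
  obtain ⟨g, hg, hcg⟩ := exists_desc_of_solution_of_unique huniq f c ℒ.L g₁ hg₁ e₁
  -- `(1_B × g)^* 𝒫_B^{rig}` as a RIGIDIFIED line bundle on `B_T`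
  let M₁ : (A.quotientBy u K hcov hG hsm hgc).RigidifiedLineBundle f :=
    { L := (Scheme.Modules.pullback ((A.quotientBy u K hcov hG hsm hgc).baseChangeToProd
          (D.hat.quotientBy u K' hcov' hG' hsm' hgc') f g hg)).obj
            (A.poincareQuotRigid u K hK hcov hG hsm hgc D hfree K' hcov' hG' hsm' hgc' Φ)
      hasRank_one := hasRank_pullback _
        (A.hasRank_poincareQuotRigid u K hK hcov hG hsm hgc D hfree K' hcov' hG' hsm' hgc' hfree' Φ)
      rigid := (A.quotientBy u K hcov hG hsm hgc).nonempty_pullback_unitSection_baseChangeToProd_iso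
        (D.hat.quotientBy u K' hcov' hG' hsm' hgc')
        (A.poincareQuotRigid u K hK hcov hG hsm hgc D hfree K' hcov' hG' hsm' hgc' Φ) f g hg
        (A.rigid_poincareQuotRigid u K hK hcov hG hsm hgc D hfree K' hcov' hG' hsm' hgc' hfree' Φ) }
  -- after `(1_B × c)^*` it is `(1_B × g₁)^* 𝒫_B^{rig} ≅ (1_B × c)^* ℒ`; (u6b) descends the isomorphism
  obtain ⟨e₀⟩ := nonempty_pullback_prodMap_pullback_baseChangeToProd_iso_of_comp_eq (A.quotientBy u K hcov hG hsm hgc)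
    (D.hat.quotientBy u K' hcov' hG' hsm' hgc') (A.poincareQuotRigid u K hK hcov hG hsm hgc D hfree K' hcov' hG' hsm' hgc' Φ)
    f c g hg g₁ hg₁ hcg
  obtain ⟨e₁⟩ := e₁
  obtain ⟨e⟩ := hdesc f c M₁ ℒ ⟨e₀ ≪≫ e₁⟩
  exact ⟨⟨g, hg⟩, ⟨e⟩⟩

include hfree' in
/-- **THE UNIVERSAL PROPERTY OF `(Â/K′, 𝒫_B^{rig})` — the `h4` binder of ★ `dualPairOfQuotientRigidified`, TOKEN-FOR-TOKEN — from
(K) `hStab`, (u6b) `hdesc` and (C) `hloc`**: for every `f : T → S` and every rigidified fibrewise-`Pic⁰` family `ℒ` on `B_T` there is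
a UNIQUE `g : T → Â/K′` over `f` with `(1_B × g)^* 𝒫_B^{rig} ≅ ℒ.L` (★ `existsUnique_poincareQuotRigid_of_exists` over
`exists_pullback_poincareQuotRigid_iso_of_fpqcLocal`).  Usage: `A.dualPairOfQuotientRigidified … Φ
(A.universal_poincareQuotRigid_of_fpqcLocal … Φ hStab hdesc hloc)`. [cite: MumfordAV1970, §15 Thm. 1 (p. 143)]
[cite: MilneAV2008, I §9 Thm. 9.1 (p. 42)] [cite: GortzWedhorn2020, Thm. 14.72] -/
theorem universal_poincareQuotRigid_of_fpqcLocal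
    (hStab : ∀ {T : Scheme.{u}} (f : T ⟶ S) (a a' : T ⟶ D.hat.X.left) (ha : a ≫ D.hat.X.hom = f)
      (ha' : a' ≫ D.hat.X.hom = f),
      Nonempty ((Scheme.Modules.pullback ((A.quotientBy u K hcov hG hsm hgc).baseChangeToProd D.hat f a ha)).obj
          (A.poincarePullbackBundle u K hK hcov hG hsm hgc D hfree).L ≅
        (Scheme.Modules.pullback ((A.quotientBy u K hcov hG hsm hgc).baseChangeToProd D.hat f a' ha')).obj
          (A.poincarePullbackBundle u K hK hcov hG hsm hgc D hfree).L) →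
      a ≫ (D.hat.quotientMk u K' hcov').left = a' ≫ (D.hat.quotientMk u K' hcov').left)
    (hdesc : ∀ {T₁ T : Scheme.{u}} (f : T ⟶ S) (c : T₁ ⟶ T) [IsAffineHom c] [Flat c] [Surjective c]
      (M₁ M₂ : (A.quotientBy u K hcov hG hsm hgc).RigidifiedLineBundle f),
      Nonempty ((Scheme.Modules.pullback ((A.quotientBy u K hcov hG hsm hgc).prodMap (c ≫ f) f c rfl)).obj M₁.L ≅
        (Scheme.Modules.pullback ((A.quotientBy u K hcov hG hsm hgc).prodMap (c ≫ f) f c rfl)).obj M₂.L) →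
      Nonempty (M₁.L ≅ M₂.L))
    (hloc : ∀ {T : Scheme.{u}} (f : T ⟶ S) (ℒ : (A.quotientBy u K hcov hG hsm hgc).RigidifiedLineBundle f),
      ℒ.FibrewisePicZero →
      ∃ (T₁ : Scheme.{u}) (c : T₁ ⟶ T) (_ : Surjective c) (_ : Flat c) (_ : QuasiCompact c) (_ : IsAffineHom c)
        (g₁ : T₁ ⟶ (D.hat.quotientBy u K' hcov' hG' hsm' hgc').X.left)
        (hg₁ : g₁ ≫ (D.hat.quotientBy u K' hcov' hG' hsm' hgc').X.hom = c ≫ f),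
        Nonempty ((Scheme.Modules.pullback ((A.quotientBy u K hcov hG hsm hgc).baseChangeToProd
            (D.hat.quotientBy u K' hcov' hG' hsm' hgc') (c ≫ f) g₁ hg₁)).obj
              (A.poincareQuotRigid u K hK hcov hG hsm hgc D hfree K' hcov' hG' hsm' hgc' Φ) ≅
          (Scheme.Modules.pullback ((A.quotientBy u K hcov hG hsm hgc).prodMap (c ≫ f) f c rfl)).obj ℒ.L)) :
    ∀ {T : Scheme.{u}} (f : T ⟶ S) (ℒ : (A.quotientBy u K hcov hG hsm hgc).RigidifiedLineBundle f),
      ℒ.FibrewisePicZero →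
      ∃! g : {g : T ⟶ (D.hat.quotientBy u K' hcov' hG' hsm' hgc').X.left //
          g ≫ (D.hat.quotientBy u K' hcov' hG' hsm' hgc').X.hom = f},
        Nonempty ((Scheme.Modules.pullback ((A.quotientBy u K hcov hG hsm hgc).baseChangeToProd
          (D.hat.quotientBy u K' hcov' hG' hsm' hgc') f g.1 g.2)).obj
            (A.poincareQuotRigid u K hK hcov hG hsm hgc D hfree K' hcov' hG' hsm' hgc' Φ) ≅ ℒ.L) :=
  fun f ℒ hℒ =>
    A.existsUnique_poincareQuotRigid_of_exists u K hK hcov hG hsm hgc D hfree K' hcov' hG' hsm' hgc' hfree' Φ hStab f ℒ.L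
      (A.exists_pullback_poincareQuotRigid_iso_of_fpqcLocal u K hK hcov hG hsm hgc D hfree K' hcov' hG' hsm' hgc' hfree' Φ
        hStab hdesc hloc f ℒ hℒ)

end AbelianSchemeOver

end Literature.AlgebraicGeometry.AbelianSchemes

end
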